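import Summits.KontsevichZagierPeriods.KontsevichZagierPeriods.Theses.AbelContraction
import Summits.KontsevichZagierPeriods.KontsevichZagierPeriods.Theorems.AbelContractionRealArcKernelStrength
import Summits.KontsevichZagierPeriods.KontsevichZagierPeriods.Theorems.LowDimensionLowdimBaker0DimLeOne
import Literature.NumberTheory.Transcendental.KZCalculusProofs
import Literature.ModelTheory.ExponentialFields.TarskiSeidenbergProofs

/-! BC5 special cases (sorry-free) of the two pieces of the redirect of `RealArcKernel`.

* piece 1 `KZDimTwo` on the sub-stratum of dimensions ≤ 1: this is LowDimension's item stmt-10622, PROVED in the tree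
  (`lowdimBaker0DimLeOne_proof`, Baker's theorem `baker_holds`);
* piece 2 `ReductionToDimensionTwo` on the part of `ker KZ.eval` generated by the representations of dimensions ≤ 1
  (semialgebraic): proved here from the normal form inside dimension one (`exists_sub_of_mem_closure_dimLEOne`, landed)
  and the monotonicity of the filtration (a 1-dim pair is one Newton–Leibniz move from a KZ-rational 2-dim pair). -/

noncomputable section
open Literature.NumberTheory.Transcendental
open Summit.KontsevichZagierPeriods.KontsevichZagierPeriods.Theses.AbelContraction (KZDimTwo ReductionToDimensionTwo)

/-- Special case of piece 1: the stratum of dimensions ≤ 1 (PROVED item stmt-10622). -/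
example : ∀ ⦃n m : ℕ⦄, n ≤ 1 → m ≤ 1 → ∀ (r : KZ.IntegralRep n) (r' : KZ.IntegralRep m),
    r.IsRational → r'.IsRational → r.value = r'.value → KZ.Equivalent r r' :=
  Summit.KontsevichZagierPeriods.LowDimension.LowdimBaker0DimLeOne.lowdimBaker0DimLeOne_proof

/-- The two statements agree on that sub-stratum (piece 1 restricted to n, m ≤ 1 IS stmt-10622). -/
example (h : KZDimTwo) : ∀ ⦃n m : ℕ⦄, n ≤ 1 → m ≤ 1 → ∀ (r : KZ.IntegralRep n) (r' : KZ.IntegralRep m),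
    r.IsRational → r'.IsRational → r.value = r'.value → KZ.Equivalent r r' :=
  fun _ _ hn hm r r' hr hr' hv => h (hn.trans one_le_two) (hm.trans one_le_two) r r' hr hr' hv

/-- Monotonicity (same lemma as in the split file). -/
theorem dimOne_pairs_of_dimTwo_pairs' {R : AddSubgroup KZ.FormalRep} (hR : KZ.relations ≤ R)
    (h : ∀ ⦃n m : ℕ⦄, n ≤ 2 → m ≤ 2 → ∀ (r : KZ.IntegralRep n) (r' : KZ.IntegralRep m),
      r.IsRational → r'.IsRational → r.value = r'.value → KZ.of r - KZ.of r' ∈ R) :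
    ∀ (r r' : KZ.IntegralRep 1), r.value = r'.value → KZ.of r - KZ.of r' ∈ R := by
  intro r r' hv
  have hTS : Literature.ModelTheory.ExponentialFields.tarski_seidenberg_real (k := ℚ) :=
    Literature.ModelTheory.ExponentialFields.tarski_seidenberg_real_holds
  have e : KZ.Equivalent r (r.graphRep hTS) := r.equivalent_graphRep hTS
  have e' : KZ.Equivalent r' (r'.graphRep hTS) := r'.equivalent_graphRep hTS
  have hv2 : (r.graphRep hTS).value = (r'.graphRep hTS).value := by
    rw [← KZ.Equivalent.value_eq_holds e, ← KZ.Equivalent.value_eq_holds e', hv]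
  have h2 : KZ.of (r.graphRep hTS) - KZ.of (r'.graphRep hTS) ∈ R :=
    h le_rfl le_rfl _ _ (r.isRational_graphRep hTS) (r'.isRational_graphRep hTS) hv2
  have : KZ.of r - KZ.of r' =
      (KZ.of r - KZ.of (r.graphRep hTS)) + (KZ.of (r.graphRep hTS) - KZ.of (r'.graphRep hTS)) -
        (KZ.of r' - KZ.of (r'.graphRep hTS)) := by abel
  rw [this]
  exact R.sub_mem (R.add_mem (hR e) h2) (hR e')

/-- **Special case of piece 2** (sorry-free): `ReductionToDimensionTwo` holds on the part of `ker KZ.eval` generated by the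
representations of dimensions ≤ 1 — every value-0 ℤ-combination of one- and zero-dimensional representations lies in every
`R ≥ KZ.relations` that contains the equal-valued KZ-rational pairs of dimensions ≤ 2. -/
theorem reductionToDimensionTwo_on_dimLEOne :
    ∀ R : AddSubgroup KZ.FormalRep, KZ.relations ≤ R →
      (∀ ⦃n m : ℕ⦄, n ≤ 2 → m ≤ 2 → ∀ (r : KZ.IntegralRep n) (r' : KZ.IntegralRep m),
        r.IsRational → r'.IsRational → r.value = r'.value → KZ.of r - KZ.of r' ∈ R) →
      ∀ x ∈ AddSubgroup.closure
          ({x : KZ.FormalRep | ∃ r : KZ.IntegralRep 1, x = KZ.of r} ∪ {x : KZ.FormalRep | ∃ c : KZ.IntegralRep 0, x = KZ.of c}),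
        KZ.eval x = 0 → x ∈ R := by
  intro R hR h2 x hx hx0
  obtain ⟨r, r', hrel⟩ :=
    Summit.KontsevichZagierPeriods.AbelContraction.RealArcKernelStrength.exists_sub_of_mem_closure_dimLEOne hx
  have hker : KZ.eval (x - (KZ.of r - KZ.of r')) = 0 := KZ.relations_le_ker_eval_holds hrel
  rw [map_sub, hx0, zero_sub, neg_eq_zero, KZ.eval_of_sub_of, sub_eq_zero] at hker
  have hpair : KZ.of r - KZ.of r' ∈ R := dimOne_pairs_of_dimTwo_pairs' hR h2 r r' hker
  have : x = (x - (KZ.of r - KZ.of r')) + (KZ.of r - KZ.of r') := by abel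
  rw [this]
  exact R.add_mem (hR hrel) hpair

/-- The genuine `ReductionToDimensionTwo` implies the special case (sanity). -/
example (h : ReductionToDimensionTwo) :
    ∀ R : AddSubgroup KZ.FormalRep, KZ.relations ≤ R →
      (∀ ⦃n m : ℕ⦄, n ≤ 2 → m ≤ 2 → ∀ (r : KZ.IntegralRep n) (r' : KZ.IntegralRep m),
        r.IsRational → r'.IsRational → r.value = r'.value → KZ.of r - KZ.of r' ∈ R) →
      ∀ x ∈ AddSubgroup.closure
          ({x : KZ.FormalRep | ∃ r : KZ.IntegralRep 1, x = KZ.of r} ∪ {x : KZ.FormalRep | ∃ c : KZ.IntegralRep 0, x = KZ.of c}),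
        KZ.eval x = 0 → x ∈ R :=
  fun R hR h2 x _ hx0 => h R hR h2 x hx0
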